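import Literature.Probability.Process.LevyCharacterisationVecMarkov
import Literature.Probability.Process.ItoIntegralRotation
import HarnessLib

/-!
# Lévy's characterisation of `n`-dimensional Brownian motion, III: continuous modifications

Topic `Probability/Process`; theorems only.  The hypothesis structure `IsBrownianVec M P` of the tree
(`BrownianVec.lean`) asks for continuous paths and `M 0 = 0` for EVERY `ω`, whereas a process obtained from
stochastic integrals (e.g. a rotated noise `∫ R dB`) has these properties only almost surely.  This file
closes the gap:

* `exists_continuous_modification` — a process with measurable marginals, a.s. continuous paths and
  `M 0 = 0` a.s. has a modification `M'` (`M' = M` for all times, a.s.) with continuous paths and `M' 0 = 0`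
  for every `ω` (zero out a measurable null set containing the bad paths);
* `isBrownianVec_of_forall_ae_eq` — if an `𝓕`-adapted `M` has the `𝓕`-Markov property, shift-invariant
  path law and Gaussian marginals (the conclusions of part II), then every such modification `M'` is an
  `n`-dimensional Brownian motion, `IsBrownianVec M' P` (independence and laws pass to a.e.-equal maps);
* ★ `exists_isBrownianVec_of_martingale` — **Lévy's characterisation, a.s. form**: coordinate martingales
  `Mⁱ` of a filtration `𝓕` with `MⁱMʲ - δ_{ij} t` martingales, a.s. continuous paths and `M 0 = 0` a.s.
  have a modification which is an `n`-dimensional Brownian motion; `M` itself has the `𝓕`-Markov property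
  (`indep_comap_vecShift_of_martingale`, part II);
* ★ `exists_isBrownianVec_orthogonalIntegral` — **application: a stochastic rotation of an `𝓕`-Brownian
  motion is an `𝓕`-Brownian motion**: with `ItoIntegralRotation.lean` (`B'ⁱ = Σⱼ ∫ R_{ij} dBʲ`, `R Rᵀ = 1`,
  martingale form) the rotated noise has increments independent of `𝓕`, Gaussian increments and a
  modification `W` with `IsBrownianVec W P` — the form in which reflection / mirror / synchronous couplings
  (Lindvall–Rogers 1986 §2, Eberle 2016) consume Lévy's theorem.

## References

* J.-F. Le Gall, *Brownian Motion, Martingales, and Stochastic Calculus*, GTM 274 (2016), Thm 5.12, and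
  §2.2 (modifications / indistinguishable versions).
* D. Revuz, M. Yor, *Continuous Martingales and Brownian Motion* (3rd ed., 1999), Ch. IV, Thm (3.6).
-/

set_option autoImplicit false

noncomputable section

open MeasureTheory ProbabilityTheory Filter Topology
open scoped NNReal ENNReal BigOperators

namespace Literature.Probability.Process

variable {Ω : Type*} {m : MeasurableSpace Ω} {P : Measure Ω} {n : ℕ}
  {M M' : ℝ≥0 → Ω → (Fin n → ℝ)} {𝓕 : Filtration ℝ≥0 m}

/-- **Continuous modification by zeroing a null set.**  A process with measurable marginals, a.s.
continuous paths and `M 0 = 0` a.s. agrees, for all times outside a null set, with a process `M'` whose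
paths are continuous with `M' 0 = 0` for EVERY `ω` (`M' = M` off a measurable null set containing the
exceptional paths, `M' = 0` on it). [cite: Legall2016, §2.2 (modifications; Def. before Thm 2.14)] -/
theorem exists_continuous_modification (hmeas : ∀ t, Measurable (M t))
    (hc : ∀ᵐ ω ∂P, Continuous (M · ω)) (h0 : ∀ᵐ ω ∂P, M 0 ω = 0) :
    ∃ M' : ℝ≥0 → Ω → (Fin n → ℝ), (∀ t, Measurable (M' t)) ∧ (∀ ω, Continuous (M' · ω)) ∧
      (∀ ω, M' 0 ω = 0) ∧ ∀ᵐ ω ∂P, ∀ t, M' t ω = M t ω := by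
  classical
  have hae : ∀ᵐ ω ∂P, Continuous (M · ω) ∧ M 0 ω = 0 := hc.and h0
  obtain ⟨N, hsub, hNm, hN0⟩ := exists_measurable_superset_of_null (ae_iff.1 hae)
  refine ⟨fun t ω ↦ if ω ∈ N then 0 else M t ω, fun t ↦ Measurable.ite hNm measurable_const (hmeas t),
    fun ω ↦ ?_, fun ω ↦ ?_, ?_⟩
  · by_cases hω : ω ∈ N
    · simp only [hω, if_true]
      exact continuous_const
    · simp only [hω, if_false]
      have h : Continuous (M · ω) ∧ M 0 ω = 0 := by
        by_contra h'
        exact hω (hsub h')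
      exact h.1
  · by_cases hω : ω ∈ N
    · simp only [hω, if_true]
    · simp only [hω, if_false]
      have h : Continuous (M · ω) ∧ M 0 ω = 0 := by
        by_contra h'
        exact hω (hsub h')
      exact h.2
  · filter_upwards [compl_mem_ae_iff.2 hN0] with ω hω t
    simp only [Set.mem_compl_iff] at hω
    simp only [hω, if_false]

/-- **A modification of an adapted process with the `𝓕`-Markov property, shift-invariant path law and
Gaussian marginals is an `n`-dimensional Brownian motion.**  Independence from the past and the laws are
transported along the a.s. equality `M' = M` (all times simultaneously). [cite: Legall2016, Thm 5.12] -/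
theorem isBrownianVec_of_forall_ae_eq [IsProbabilityMeasure P] (hadapt : ∀ t, Measurable[𝓕 t] (M t))
    (hind : ∀ s, Indep (MeasurableSpace.comap (vecShift M s) inferInstance) (𝓕 s) P)
    (hshift : ∀ s, P.map (vecShift M s) = P.map (vecPath M)) (hlaw : ∀ t, P.map (M t) = gaussVec n t)
    (hM'm : ∀ t, Measurable (M' t)) (hM'c : ∀ ω, Continuous (M' · ω)) (hM'0 : ∀ ω, M' 0 ω = 0)
    (hae : ∀ᵐ ω ∂P, ∀ t, M' t ω = M t ω) : IsBrownianVec M' P where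
  measurable := hM'm
  continuous_path := hM'c
  apply_zero := hM'0
  indep_shift s := by
    have hpast : Measurable[𝓕 s] (vecPast M s) :=
      @measurable_pi_lambda _ _ _ (𝓕 s) _ _ fun r ↦ (hadapt r).mono (𝓕.mono r.2) le_rfl
    have h1 : IndepFun (vecShift M s) (vecPast M s) P := by
      rw [IndepFun_iff_Indep]
      exact indep_of_indep_of_le_right (hind s) hpast.comap_le
    refine h1.congr ?_ ?_
    · filter_upwards [hae] with ω hω
      funext u
      simp only [vecShift, hω]
    · filter_upwards [hae] with ω hω
      funext r
      simp only [vecPast, hω]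
  map_shift s := by
    have e1 : P.map (vecShift M' s) = P.map (vecShift M s) := by
      refine Measure.map_congr ?_
      filter_upwards [hae] with ω hω
      funext u
      simp only [vecShift, hω]
    have e2 : P.map (vecPath M') = P.map (vecPath M) := by
      refine Measure.map_congr ?_
      filter_upwards [hae] with ω hω
      funext u
      simp only [vecPath, hω]
    rw [e1, e2, hshift s]
  map_apply t := by
    rw [← hlaw t]
    refine Measure.map_congr ?_
    filter_upwards [hae] with ω hω
    exact hω t

/-- ★ **Lévy's characterisation of `n`-dimensional Brownian motion, a.s. form.**  If the coordinates `Mⁱ`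
of `M : ℝ≥0 → Ω → ℝⁿ` are martingales of a filtration `𝓕` on a probability space with `MⁱMʲ - δ_{ij} t`
martingales, the paths are a.s. continuous and `M 0 = 0` a.s., then `M` has a modification `W` (`W = M` at
all times, a.s.) which is an `n`-dimensional Brownian motion, `IsBrownianVec W P`; moreover `M` (hence `W`)
has increments independent of `𝓕`: `indep_comap_vecShift_of_martingale`. [cite: Legall2016, Thm 5.12] -/
theorem exists_isBrownianVec_of_martingale [IsProbabilityMeasure P]
    (hMi : ∀ i, Martingale (fun t ω ↦ M t ω i) 𝓕 P)
    (hMik : ∀ i k, Martingale (fun t ω ↦ M t ω i * M t ω k - if i = k then (t : ℝ) else 0) 𝓕 P)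
    (h0 : ∀ᵐ ω ∂P, M 0 ω = 0) (hc : ∀ᵐ ω ∂P, Continuous (M · ω)) :
    ∃ W : ℝ≥0 → Ω → (Fin n → ℝ), IsBrownianVec W P ∧ ∀ᵐ ω ∂P, ∀ t, W t ω = M t ω := by
  have hadapt : ∀ t, Measurable[𝓕 t] (M t) := fun t ↦
    @measurable_pi_lambda _ _ _ (𝓕 t) _ _ fun i ↦ ((hMi i).stronglyMeasurable t).measurable
  have hmeas : ∀ t, Measurable (M t) := fun t ↦ (hadapt t).mono (𝓕.le t) le_rfl
  obtain ⟨W, hWm, hWc, hW0, hae⟩ := exists_continuous_modification hmeas hc h0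
  have hM := forall_isLocalMartingale_dot_of_martingale hMi hMik
  refine ⟨W, isBrownianVec_of_forall_ae_eq hadapt (indep_comap_vecShift hM hadapt h0 hc)
    (map_vecShift_eq_map_vecPath hM hadapt h0 hc) (fun t ↦ (hasLaw_gaussVec hM h0 hc t).map_eq)
    hWm hWc hW0 hae, hae⟩

/-! ### Application: stochastic rotations `∫ R dB`, `R Rᵀ = 1` -/

section Rotation

variable {𝓖 : Filtration ℝ≥0 m} {d d' : ℕ} {B : ℝ≥0 → Ω → (Fin d → ℝ)}
  {R : ℝ≥0 → Ω → Matrix (Fin d') (Fin d) ℝ}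

/-- ★ **A stochastic rotation of an `𝓖`-Brownian motion is an `𝓖`-Brownian motion.**  Let the coordinates
of `B : ℝ≥0 → Ω → ℝᵈ` be continuous square-integrable martingales of a filtration `𝓖` on a probability space
with `BʲBˡ - δ_{jl} t` martingales, and let `R` be an `𝓖`-progressive `d' × d` matrix process with
`R Rᵀ = 1`.  Then the process `B'ⁱ = Σⱼ ∫ R_{ij} dBʲ` (Itô integrals `IsItoIntegral`) is a `d'`-dimensional
`𝓖`-Brownian motion: its coordinates are `𝓖`-martingales with brackets `δ_{ik} t`, its shifted process
`u ↦ B'_{s+u} - B'_s` is independent of `𝓖 s`, its increments are `N(0, (t-s)I)`, and it has a modification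
`W` with `IsBrownianVec W P`. [cite: RevuzYor1999, Ch. IV Thm (3.6)] -/
theorem exists_isBrownianVec_orthogonalIntegral [IsProbabilityMeasure P]
    (hBm : ∀ j, Martingale (fun t ω ↦ B t ω j) 𝓖 P)
    (hBB : ∀ j l, Martingale (fun t ω ↦ B t ω j * B t ω l - if j = l then (t : ℝ) else 0) 𝓖 P)
    (hB2 : ∀ t j, MemLp (fun ω ↦ B t ω j) 2 P) (hBc : ∀ j ω, Continuous fun t ↦ B t ω j)
    (hR : ∀ i j, IsStronglyProgressive 𝓖 (fun t ω ↦ R t ω i j))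
    (hRO : ∀ t ω, R t ω * (R t ω).transpose = 1) :
    ∃ B' W : ℝ≥0 → Ω → (Fin d' → ℝ),
      (∃ J : Fin d' → Fin d → ℝ≥0 → Ω → ℝ,
        (∀ i j, IsItoIntegral (fun t ω ↦ R t ω i j) (fun t ω ↦ B t ω j) (J i j) 𝓖 P) ∧
        ∀ t ω i, B' t ω i = ∑ j, J i j t ω) ∧
      (∀ i, Martingale (fun t ω ↦ B' t ω i) 𝓖 P) ∧
      (∀ i k, Martingale (fun t ω ↦ B' t ω i * B' t ω k - if i = k then (t : ℝ) else 0) 𝓖 P) ∧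
      (∀ s, Indep (MeasurableSpace.comap (vecShift B' s) inferInstance) (𝓖 s) P) ∧
      (∀ s t : ℝ≥0, s ≤ t → HasLaw (fun ω ↦ B' t ω - B' s ω) (gaussVec d' (t - s)) P) ∧
      IsBrownianVec W P ∧ ∀ᵐ ω ∂P, ∀ t, W t ω = B' t ω := by
  obtain ⟨B', hJ, hM, hMM, -, h0, hc⟩ := exists_orthogonalIntegral hBm hBB hB2 hBc hR hRO
  have h0' : ∀ᵐ ω ∂P, B' 0 ω = 0 := ae_of_all _ h0
  obtain ⟨W, hW, hae⟩ := exists_isBrownianVec_of_martingale hM hMM h0' hc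
  exact ⟨B', W, hJ, hM, hMM, fun s ↦ indep_comap_vecShift_of_martingale hM hMM h0' hc s,
    fun s t hst ↦ hasLaw_sub_gaussVec_of_martingale hM hMM h0' hc hst, hW, hae⟩

end Rotation

end Literature.Probability.Process

end
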